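import Summits.AtomisticToContinuum.HydrodynamicLimit.Theorems.OneFlightGossipEngineCollisionActivityTailsActivityDomination
import Summits.AtomisticToContinuum.HydrodynamicLimit.Theorems.JParityClosureCollisionTightnessSweptTube
import Summits.AtomisticToContinuum.HydrodynamicLimit.Theorems.JParityClosureCollisionTightnessTorusGibbs
import Literature.MathematicalPhysics.KineticTheory.CollisionFluxUpperBound
import Mathlib.Analysis.SpecialFunctions.Gaussian.FourierTransform
import HarnessLib

/-!
# `CollisionActivityTails` (stmt-AtomisticToContinuum-13734), line `plaque-thinning-count-ld`, stub 5 (abnormal activity):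
the STATICS of the hot half — pair-law envelopes, one-window events, the hot two-point flux and its Gaussian tail

Helper file (`--supports stmt-AtomisticToContinuum-13734`), companion of `…Theorems.CollisionActivityTailsAbnormalActivity`
(the window collision-flux inequality for a non-stationary law and the reduction of stub 5' to its hot and tagged halves) and of
`…Theorems.CollisionActivityTailsAbnormalActivityHot` (the hot half from a pair-law envelope). Independent of both: it only
uses the phase-space vocabulary `Cfg` of `…ActivityDomination`, the swept-tube geometry of
`…JParityClosureCollisionTightnessSweptTube` / `…TorusGibbs`, and the torus one-window geometry
`exists_latticeVec_add_mem_of_contact` of `Literature.MathematicalPhysics.KineticTheory.CollisionFluxUpperBound`.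

* §5 `hotMark` (the mark `|v_k - v_l| 𝟙{|v_k - v_l| > Θ}` of an ordered pair), `PairLawEnvelope μ C β` (the joint law of
  `(x_k - x_l, v_k, v_l)` under `μ` is `≤ C² e^{-β E₂} ×` Haar ⊗ Lebesgue² — the only property of the laws at the times of the
  window the hot half consumes), the one-window event `windowEvent S k l` cut from a swept-tube family (`mem_windowEvent_of_contact`:
  it contains every configuration whose pair reaches contact under a short backward free flight), and its static bound
  `lintegral_windowEvent_hotMark_le`: `∫ 𝟙_{E(k,l)} hotMark dμ ≤ C² · 4 ε² h · I(β, Θ)`;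
* §6 the hot two-point flux `hotFluxIntegral β Θ = ∫∫ |v-v'|² 𝟙{|v-v'|>Θ} e^{-β(|v|²+|v'|²)/2}` is finite and tends to `0` as
  `Θ → ∞` (dominated convergence against `(8/β) e^{-β|v|²/4} e^{-β|v'|²/4}`; `exists_hotFluxIntegral_le`).

References: C. Cercignani, R. Illner, M. Pulvirenti, *The Mathematical Theory of Dilute Gases* (1994), App. 4.A (collision
cylinders); I. Gallagher, L. Saint-Raymond, B. Texier, *From Newton to Boltzmann* (2013), Prop. 4.1.1. Elementary; recorded here.
-/

noncomputable section

open MeasureTheory Set Filter Topology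
open scoped ENNReal InnerProductSpace

namespace Summit.AtomisticToContinuum.HydrodynamicLimit.Theorems.CollisionActivityTailsAbnormalActivityStatics

open Literature.MathematicalPhysics.KineticTheory Literature.Analysis.FluidPDE
open Summit.AtomisticToContinuum.HydrodynamicLimit.Theorems.CollisionActivityTailsActivityDomination (Cfg)

/-! ## §5 The one-window event of a pair and its static bound under a pair-law envelope -/

section PairStatics

open Literature.Analysis.FunctionSpaces (Torus.latticeVec)

variable {N : ℕ}

/-- The HOT MARK of an ordered pair: `|v_k - v_l| 𝟙{|v_k - v_l| > Θ}` (a measurable function of the two velocities,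
hence unchanged by free flight), with values in `ℝ≥0∞`. -/
def hotMark (Θ : ℝ) (w : Cfg N) (k l : Fin (N + 1)) : ℝ≥0∞ :=
  if Θ < ‖(w k).2 - (w l).2‖ then ENNReal.ofReal ‖(w k).2 - (w l).2‖ else 0

/-- The hot mark is measurable in the configuration. -/
theorem measurable_hotMark (Θ : ℝ) (k l : Fin (N + 1)) : Measurable fun w : Cfg N => hotMark Θ w k l := by
  unfold hotMark
  have hm : Measurable fun w : Cfg N => ‖(w k).2 - (w l).2‖ :=
    ((measurable_pi_apply k).snd.sub (measurable_pi_apply l).snd).norm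
  exact Measurable.ite (measurableSet_lt measurable_const hm) hm.ennreal_ofReal measurable_const

/-- The hot mark is unchanged by free flight (velocities are). -/
theorem hotMark_freeFlight (Θ t : ℝ) (w : Cfg N) (k l : Fin (N + 1)) :
    hotMark Θ (freeFlight (Torus.geometry (Fin 3)) t w) k l = hotMark Θ w k l := by
  simp only [hotMark, freeFlight_apply]

/-- The Gaussian pair weight `e^{-β E₂}`, `E₂ = ½ (|v|² + |v'|²)` (the `k = 2` weight of an envelope with constant `β`). -/
def gaussPairWeight (β : ℝ) (vv : V3 × V3) : ℝ≥0∞ :=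
  ENNReal.ofReal (Real.exp (-(β * (2⁻¹ * (‖vv.1‖ ^ 2 + ‖vv.2‖ ^ 2)))))

/-- The Gaussian pair weight is measurable. -/
theorem measurable_gaussPairWeight (β : ℝ) : Measurable (gaussPairWeight β) := by
  unfold gaussPairWeight; fun_prop

/-- The hot mark as a function of the two velocities: `|v - v'| 𝟙{|v - v'| > Θ}`. -/
def hotPairMark (Θ : ℝ) (vv : V3 × V3) : ℝ≥0∞ :=
  if Θ < ‖vv.1 - vv.2‖ then ENNReal.ofReal ‖vv.1 - vv.2‖ else 0

/-- The hot pair mark is measurable. -/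
theorem measurable_hotPairMark (Θ : ℝ) : Measurable (hotPairMark Θ) := by
  unfold hotPairMark
  have hm : Measurable fun vv : V3 × V3 => ‖vv.1 - vv.2‖ := (measurable_fst.sub measurable_snd).norm
  exact Measurable.ite (measurableSet_lt measurable_const hm) hm.ennreal_ofReal measurable_const

/-- `hotMark` is the hot pair mark of the two velocities. -/
theorem hotMark_eq_hotPairMark (Θ : ℝ) (w : Cfg N) (k l : Fin (N + 1)) :
    hotMark Θ w k l = hotPairMark Θ ((w k).2, (w l).2) := rfl

/-- **The hot two-point flux integral** `I(β, Θ) = ∫∫ |v - v'|² 𝟙{|v - v'| > Θ} e^{-β(|v|²+|v'|²)/2} dv dv'` (Lebesgue on `ℝ³ × ℝ³`):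
the outgoing contact flux of the hot mark under the Gaussian pair envelope, up to the cross-section factor. -/
def hotFluxIntegral (β Θ : ℝ) : ℝ≥0∞ :=
  ∫⁻ vv : V3 × V3, hotPairMark Θ vv * ENNReal.ofReal ‖vv.2 - vv.1‖ * gaussPairWeight β vv

/-- **PAIR-LAW ENVELOPE** of a law `μ` on `(N+1)`-configurations with constants `(C, β)`: for every ordered pair of labels `k ≠ l`
the joint law of (position difference `x_k - x_l ∈ 𝕋³`, `v_k`, `v_l`) under `μ` is at most `C² e^{-β E₂} ×` (Haar ⊗ Lebesgue ⊗
Lebesgue) — the `k = 2` instance of a marginal envelope `|f^{(2)}| ≤ C² e^{-β E₂}` after relabelling symmetry, Tonelli over the other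
`N - 1` particles and translation invariance of Haar measure (`∫∫ G(x - x') dx dx' = ∫ G`). This is the ONLY property of the laws at the
times of the window that the hot half consumes. -/
def PairLawEnvelope (μ : Measure (Cfg N)) (C β : ℝ) : Prop :=
  ∀ k l : Fin (N + 1), k ≠ l → ∀ G : T3 × V3 × V3 → ℝ≥0∞, Measurable G →
    ∫⁻ w, G ((w k).1 - (w l).1, (w k).2, (w l).2) ∂μ ≤
      ENNReal.ofReal (C ^ 2) * ∫⁻ q : T3 × V3 × V3, G q * gaussPairWeight β q.2

/-- The ONE-WINDOW EVENT of the ordered pair `(k, l)` cut from a swept-tube family `S` (cf. `exists_windowEvent_of_pairBound`): some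
minimal-image lift of the relative position `x_k - x_l` lies in the tube `S (v_l - v_k)` swept by the contact sphere. -/
def windowEvent (S : V3 → Set V3) (k l : Fin (N + 1)) : Set (Cfg N) :=
  {w | ∃ kv : Fin 3 → ℤ, Torus.reprSym ((w k).1 - (w l).1) + Torus.latticeVec kv ∈ S ((w l).2 - (w k).2)}

/-- The pair set of a tube family in the coordinates (position difference, `v_k`, `v_l`). -/
def pairTubeSet (S : V3 → Set V3) : Set (T3 × V3 × V3) :=
  {q | ∃ kv : Fin 3 → ℤ, Torus.reprSym q.1 + Torus.latticeVec kv ∈ S (q.2.2 - q.2.1)}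

/-- The window event is the preimage of the pair set under the pair coordinates. -/
theorem windowEvent_eq_preimage (S : V3 → Set V3) (k l : Fin (N + 1)) :
    windowEvent S k l = (fun w : Cfg N => ((w k).1 - (w l).1, (w k).2, (w l).2)) ⁻¹' pairTubeSet S := rfl

/-- The pair coordinates are measurable. -/
theorem measurable_pairCoord (k l : Fin (N + 1)) :
    Measurable fun w : Cfg N => ((w k).1 - (w l).1, (w k).2, (w l).2) :=
  ((measurable_pi_apply k).fst.sub (measurable_pi_apply l).fst).prodMk
    ((measurable_pi_apply k).snd.prodMk (measurable_pi_apply l).snd)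

/-- The pair set of a jointly measurable tube family is measurable (countable union over the lattice). -/
theorem measurableSet_pairTubeSet {S : V3 → Set V3} (hSm : MeasurableSet {q : V3 × V3 | q.1 ∈ S q.2}) :
    MeasurableSet (pairTubeSet S) := by
  have h : pairTubeSet S = ⋃ kv : Fin 3 → ℤ,
      (fun q : T3 × V3 × V3 => (Torus.reprSym q.1 + Torus.latticeVec kv, q.2.2 - q.2.1)) ⁻¹' {q : V3 × V3 | q.1 ∈ S q.2} := by
    ext q; simp only [pairTubeSet, mem_setOf_eq, mem_iUnion, mem_preimage]
  rw [h]
  refine MeasurableSet.iUnion fun kv => hSm.preimage ?_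
  exact ((Torus.measurable_reprSym.comp measurable_fst).add_const _).prodMk
    ((measurable_snd.comp measurable_snd).sub (measurable_fst.comp measurable_snd))

/-- The window event of a jointly measurable tube family is measurable. -/
theorem measurableSet_windowEvent {S : V3 → Set V3} (hSm : MeasurableSet {q : V3 × V3 | q.1 ∈ S q.2}) (k l : Fin (N + 1)) :
    MeasurableSet (windowEvent S k l : Set (Cfg N)) := by
  rw [windowEvent_eq_preimage]
  exact (measurableSet_pairTubeSet hSm).preimage (measurable_pairCoord k l)

/-- **The window event contains every configuration whose pair comes to contact under a backward free flight of duration `≤ h`**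
(the hypothesis `hE` of §1), if the tube family contains every non-overlapping relative position swept into contact
(`exists_latticeVec_add_mem_of_contact`: a lift of the minimal image lies in the tube). -/
theorem mem_windowEvent_of_contact {ε h : ℝ} {S : V3 → Set V3}
    (hS : ∀ (u r : V3) (s : ℝ), ε ≤ ‖r‖ → s ∈ Icc 0 h → ‖r + s • u‖ = ε → r ∈ S u) {k l : Fin (N + 1)} (hkl : k ≠ l)
    {w : Cfg N} (hw : w ∈ hardSphereDomain (Torus.geometry (Fin 3)) (N + 1) ε) {t : ℝ} (ht : t ∈ Icc 0 h)
    (hc : ‖(Torus.geometry (Fin 3)).sepVec ((freeFlight (Torus.geometry (Fin 3)) (-t) w k).1)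
      ((freeFlight (Torus.geometry (Fin 3)) (-t) w l).1)‖ = ε) :
    w ∈ windowEvent S k l :=
  exists_latticeVec_add_mem_of_contact hS hw hkl ht hc

/-- On the window event the hot mark is the pair-set indicator of the hot pair mark, read in the pair coordinates. -/
theorem indicator_windowEvent_hotMark (S : V3 → Set V3) (Θ : ℝ) (k l : Fin (N + 1)) (w : Cfg N) :
    (windowEvent S k l).indicator (fun w => hotMark Θ w k l) w =
      (pairTubeSet S).indicator (fun q => hotPairMark Θ q.2) ((w k).1 - (w l).1, (w k).2, (w l).2) := by
  rw [windowEvent_eq_preimage]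
  rfl

/-- **The static one-window bound for one pair under a pair-law envelope**: for a tube family of volume `≤ 4 ε² h |u|` (`hSvol`),
`∫ 𝟙_{E(k,l)} hotMark dμ ≤ C² · 4 ε² h · I(β, Θ)` (the minimal-image lift costs nothing:
`volume_setOf_exists_reprSym_add_latticeVec_mem_le`). -/
theorem lintegral_windowEvent_hotMark_le {μ : Measure (Cfg N)} {C β : ℝ} (hμ : PairLawEnvelope μ C β) {k l : Fin (N + 1)}
    (hkl : k ≠ l) {ε h : ℝ} (hεh : 0 ≤ 4 * ε ^ 2 * h) {S : V3 → Set V3} (hSm : MeasurableSet {q : V3 × V3 | q.1 ∈ S q.2})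
    (hSvol : ∀ u, volume (S u) ≤ ENNReal.ofReal (4 * ε ^ 2 * h * ‖u‖)) (Θ : ℝ) :
    ∫⁻ w, (windowEvent S k l).indicator (fun w => hotMark Θ w k l) w ∂μ ≤
      ENNReal.ofReal (C ^ 2) * (ENNReal.ofReal (4 * ε ^ 2 * h) * hotFluxIntegral β Θ) := by
  have hTm := measurableSet_pairTubeSet hSm
  set G : T3 × V3 × V3 → ℝ≥0∞ := (pairTubeSet S).indicator (fun q => hotPairMark Θ q.2) with hG
  have hGm : Measurable G := ((measurable_hotPairMark Θ).comp measurable_snd).indicator hTm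
  simp_rw [indicator_windowEvent_hotMark]
  refine (hμ k l hkl G hGm).trans ?_
  gcongr
  -- Tonelli: integrate the position difference first; the section of the pair set has Haar measure ≤ vol (S u) ≤ 4 ε² h |u|
  have hsec : ∀ vv : V3 × V3, volume {p : T3 | (p, vv) ∈ pairTubeSet S} ≤ ENNReal.ofReal (4 * ε ^ 2 * h * ‖vv.2 - vv.1‖) := by
    intro vv
    have hSu : MeasurableSet (S (vv.2 - vv.1)) := hSm.preimage (measurable_id.prodMk measurable_const)
    have h1 := volume_setOf_exists_reprSym_add_latticeVec_mem_le (0 : T3) hSu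
    simp only [sub_zero] at h1
    exact h1.trans (hSvol _)
  have hprod : (volume : Measure (T3 × V3 × V3)) = (volume : Measure T3).prod (volume : Measure (V3 × V3)) := rfl
  have hGm' : Measurable fun q : T3 × V3 × V3 => G q * gaussPairWeight β q.2 :=
    hGm.mul ((measurable_gaussPairWeight β).comp measurable_snd)
  rw [hprod, lintegral_prod_symm (fun q : T3 × V3 × V3 => G q * gaussPairWeight β q.2) hGm'.aemeasurable]
  unfold hotFluxIntegral
  rw [← lintegral_const_mul' _ _ ENNReal.ofReal_ne_top]
  refine lintegral_mono fun vv => ?_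
  have hind : ∀ p : T3, G (p, vv) * gaussPairWeight β vv =
      {p : T3 | (p, vv) ∈ pairTubeSet S}.indicator (fun _ => hotPairMark Θ vv * gaussPairWeight β vv) p := by
    intro p
    by_cases hp : (p, vv) ∈ pairTubeSet S
    · rw [hG, indicator_of_mem hp, indicator_of_mem (show p ∈ {p : T3 | (p, vv) ∈ pairTubeSet S} from hp)]
    · rw [hG, indicator_of_notMem hp, indicator_of_notMem (show p ∉ {p : T3 | (p, vv) ∈ pairTubeSet S} from hp), zero_mul]
  have hsecm : MeasurableSet {p : T3 | (p, vv) ∈ pairTubeSet S} := hTm.preimage (measurable_id.prodMk measurable_const)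
  simp_rw [hind]
  rw [lintegral_indicator_const hsecm]
  calc hotPairMark Θ vv * gaussPairWeight β vv * volume {p : T3 | (p, vv) ∈ pairTubeSet S}
      ≤ hotPairMark Θ vv * gaussPairWeight β vv * ENNReal.ofReal (4 * ε ^ 2 * h * ‖vv.2 - vv.1‖) := by gcongr; exact hsec vv
    _ = ENNReal.ofReal (4 * ε ^ 2 * h) * (hotPairMark Θ vv * ENNReal.ofReal ‖vv.2 - vv.1‖ * gaussPairWeight β vv) := by
        rw [ENNReal.ofReal_mul hεh]; ring

end PairStatics

/-! ## §6 The hot two-point flux is Gaussian-small in the cap `Θ` -/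

section GaussTail

/-- `x ≤ e^x / 1`: the elementary bound `|v - v'|² e^{-β(|v|²+|v'|²)/2} ≤ (8/β) e^{-β|v|²/4} e^{-β|v'|²/4}`
(`|v - v'|² ≤ 2|v|² + 2|v'|² = (8/β) · β(|v|²+|v'|²)/4 ≤ (8/β) e^{β(|v|²+|v'|²)/4}`). -/
theorem norm_sub_sq_mul_exp_le {β : ℝ} (hβ : 0 < β) (v v' : V3) :
    ‖v - v'‖ ^ 2 * Real.exp (-(β * (2⁻¹ * (‖v‖ ^ 2 + ‖v'‖ ^ 2)))) ≤
      8 / β * (Real.exp (-(β / 4 * ‖v‖ ^ 2)) * Real.exp (-(β / 4 * ‖v'‖ ^ 2))) := by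
  have h1 : ‖v - v'‖ ^ 2 ≤ 2 * ‖v‖ ^ 2 + 2 * ‖v'‖ ^ 2 := by
    have h := norm_sub_le v v'
    nlinarith [norm_nonneg (v - v'), norm_nonneg v, norm_nonneg v', sq_nonneg (‖v‖ - ‖v'‖)]
  set x : ℝ := β / 4 * (‖v‖ ^ 2 + ‖v'‖ ^ 2) with hx
  have hx0 : 0 ≤ x := by positivity
  have h2 : 2 * ‖v‖ ^ 2 + 2 * ‖v'‖ ^ 2 = 8 / β * x := by rw [hx]; field_simp; ring
  have h3 : x ≤ Real.exp x := by linarith [Real.add_one_le_exp x]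
  have h4 : Real.exp x * Real.exp (-(β * (2⁻¹ * (‖v‖ ^ 2 + ‖v'‖ ^ 2)))) =
      Real.exp (-(β / 4 * ‖v‖ ^ 2)) * Real.exp (-(β / 4 * ‖v'‖ ^ 2)) := by
    rw [← Real.exp_add, ← Real.exp_add, hx]; ring_nf
  calc ‖v - v'‖ ^ 2 * Real.exp (-(β * (2⁻¹ * (‖v‖ ^ 2 + ‖v'‖ ^ 2))))
      ≤ (8 / β * Real.exp x) * Real.exp (-(β * (2⁻¹ * (‖v‖ ^ 2 + ‖v'‖ ^ 2)))) := by
        gcongr; exact h1.trans (h2 ▸ by gcongr)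
    _ = 8 / β * (Real.exp (-(β / 4 * ‖v‖ ^ 2)) * Real.exp (-(β / 4 * ‖v'‖ ^ 2))) := by rw [mul_assoc, h4]

/-- The integrand of `I(β, Θ)` is dominated by `ofReal (|v - v'|² e^{-β E₂})` (drop the cap). -/
theorem hotFluxIntegrand_le (β Θ : ℝ) (vv : V3 × V3) :
    hotPairMark Θ vv * ENNReal.ofReal ‖vv.2 - vv.1‖ * gaussPairWeight β vv ≤
      ENNReal.ofReal (‖vv.1 - vv.2‖ ^ 2 * Real.exp (-(β * (2⁻¹ * (‖vv.1‖ ^ 2 + ‖vv.2‖ ^ 2))))) := by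
  have hmark : hotPairMark Θ vv ≤ ENNReal.ofReal ‖vv.1 - vv.2‖ := by
    unfold hotPairMark; split_ifs; exacts [le_rfl, bot_le]
  calc hotPairMark Θ vv * ENNReal.ofReal ‖vv.2 - vv.1‖ * gaussPairWeight β vv
      ≤ ENNReal.ofReal ‖vv.1 - vv.2‖ * ENNReal.ofReal ‖vv.2 - vv.1‖ * gaussPairWeight β vv := by gcongr
    _ = _ := by
        rw [norm_sub_rev vv.2 vv.1, gaussPairWeight, ← ENNReal.ofReal_mul (norm_nonneg _),
          ← ENNReal.ofReal_mul (by positivity), ← sq]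

/-- A Gaussian has finite Lebesgue integral on `ℝ³`: `∫ e^{-b|v|²} dv < ∞` for `b > 0` (Mathlib's `integral_rexp_neg_mul_sq_norm`
evaluates the integral to `(π/b)^{3/2} ≠ 0`, whence integrability). -/
theorem lintegral_exp_neg_mul_sq_lt_top {b : ℝ} (hb : 0 < b) :
    ∫⁻ v : V3, ENNReal.ofReal (Real.exp (-(b * ‖v‖ ^ 2))) < ⊤ := by
  have hint : Integrable (fun v : V3 => Real.exp (-b * ‖v‖ ^ 2)) := by
    refine Integrable.of_integral_ne_zero ?_
    rw [GaussianFourier.integral_rexp_neg_mul_sq_norm hb]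
    positivity
  simpa only [neg_mul] using hint.lintegral_lt_top

/-- **The uncapped hot flux is finite**: `∫∫ |v - v'|² e^{-β(|v|²+|v'|²)/2} dv dv' < ∞`. -/
theorem lintegral_hotFluxDominant_lt_top {β : ℝ} (hβ : 0 < β) :
    ∫⁻ vv : V3 × V3, ENNReal.ofReal (‖vv.1 - vv.2‖ ^ 2 * Real.exp (-(β * (2⁻¹ * (‖vv.1‖ ^ 2 + ‖vv.2‖ ^ 2))))) < ⊤ := by
  have hb4 : 0 < β / 4 := by positivity
  set g : V3 → ℝ≥0∞ := fun v => ENNReal.ofReal (Real.exp (-(β / 4 * ‖v‖ ^ 2))) with hg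
  have hgm : Measurable g := by rw [hg]; fun_prop
  have hgfin : ∫⁻ v, g v < ⊤ := lintegral_exp_neg_mul_sq_lt_top hb4
  calc ∫⁻ vv : V3 × V3, ENNReal.ofReal (‖vv.1 - vv.2‖ ^ 2 * Real.exp (-(β * (2⁻¹ * (‖vv.1‖ ^ 2 + ‖vv.2‖ ^ 2)))))
      ≤ ∫⁻ vv : V3 × V3, ENNReal.ofReal (8 / β) * (g vv.1 * g vv.2) := by
        refine lintegral_mono fun vv => ?_
        rw [hg, ← ENNReal.ofReal_mul (Real.exp_nonneg _), ← ENNReal.ofReal_mul (by positivity)]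
        exact ENNReal.ofReal_le_ofReal (norm_sub_sq_mul_exp_le hβ vv.1 vv.2)
    _ = ENNReal.ofReal (8 / β) * ((∫⁻ v, g v) * ∫⁻ v, g v) := by
        rw [lintegral_const_mul' _ _ ENNReal.ofReal_ne_top,
          show (volume : Measure (V3 × V3)) = (volume : Measure V3).prod volume from rfl,
          lintegral_prod_mul hgm.aemeasurable hgm.aemeasurable]
    _ < ⊤ := ENNReal.mul_lt_top ENNReal.ofReal_lt_top (ENNReal.mul_lt_top hgfin hgfin)

/-- The hot flux integrand is measurable. -/
theorem measurable_hotFluxIntegrand (β Θ : ℝ) :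
    Measurable fun vv : V3 × V3 => hotPairMark Θ vv * ENNReal.ofReal ‖vv.2 - vv.1‖ * gaussPairWeight β vv :=
  ((measurable_hotPairMark Θ).mul (measurable_snd.sub measurable_fst).norm.ennreal_ofReal).mul (measurable_gaussPairWeight β)

/-- **The hot two-point flux vanishes as the cap grows**: `I(β, n) → 0` (dominated convergence; pointwise the cap eventually
kills every pair of velocities). -/
theorem tendsto_hotFluxIntegral {β : ℝ} (hβ : 0 < β) :
    Tendsto (fun n : ℕ => hotFluxIntegral β n) atTop (𝓝 0) := by
  have h := tendsto_lintegral_of_dominated_convergence (μ := (volume : Measure (V3 × V3)))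
    (F := fun (n : ℕ) (vv : V3 × V3) => hotPairMark n vv * ENNReal.ofReal ‖vv.2 - vv.1‖ * gaussPairWeight β vv)
    (f := fun _ => 0) _ (fun n => measurable_hotFluxIntegrand β n)
    (fun n => Eventually.of_forall fun vv => hotFluxIntegrand_le β n vv) (lintegral_hotFluxDominant_lt_top hβ).ne
    (Eventually.of_forall fun vv => ?_)
  · unfold hotFluxIntegral
    simpa only [lintegral_zero] using h
  · refine tendsto_const_nhds.congr' ?_
    filter_upwards [eventually_ge_atTop ⌈‖vv.1 - vv.2‖⌉₊] with n hn
    have hlt : ¬ ((n : ℝ) < ‖vv.1 - vv.2‖) := not_lt.2 ((Nat.le_ceil _).trans (by exact_mod_cast hn))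
    simp only [hotPairMark, if_neg hlt, zero_mul]

/-- Hence for every `δ > 0` some positive cap makes the hot flux `≤ δ`. -/
theorem exists_hotFluxIntegral_le {β : ℝ} (hβ : 0 < β) {δ : ℝ≥0∞} (hδ : 0 < δ) :
    ∃ Θ : ℝ, 0 < Θ ∧ hotFluxIntegral β Θ ≤ δ := by
  have h := (tendsto_hotFluxIntegral hβ).eventually (Iio_mem_nhds hδ)
  obtain ⟨n, hn⟩ := (h.and (eventually_ge_atTop 1)).exists
  exact ⟨n, by exact_mod_cast hn.2, le_of_lt hn.1⟩

end GaussTail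


/-- **Registered helper sub-goal `stub_hotMarkStatics`** (line `plaque-thinning-count-ld`, stub 5, hot half): the static one-window bound
for one ordered pair under a pair-law envelope (`lintegral_windowEvent_hotMark_le`, closed form). -/
theorem stub_hotMarkStatics : ∀ {N : ℕ} {μ : Measure (Cfg N)} {C β : ℝ}, PairLawEnvelope μ C β → ∀ {k l : Fin (N + 1)}, k ≠ l → ∀ {ε h : ℝ}, 0 ≤ 4 * ε ^ 2 * h → ∀ {S : V3 → Set V3}, MeasurableSet {q : V3 × V3 | q.1 ∈ S q.2} → (∀ u, volume (S u) ≤ ENNReal.ofReal (4 * ε ^ 2 * h * ‖u‖)) → ∀ Θ : ℝ, ∫⁻ w, (windowEvent S k l).indicator (fun w => hotMark Θ w k l) w ∂μ ≤ ENNReal.ofReal (C ^ 2) * (ENNReal.ofReal (4 * ε ^ 2 * h) * hotFluxIntegral β Θ) :=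
  fun hμ _ _ hkl _ _ hεh _ hSm hSvol Θ => lintegral_windowEvent_hotMark_le hμ hkl hεh hSm hSvol Θ

end Summit.AtomisticToContinuum.HydrodynamicLimit.Theorems.CollisionActivityTailsAbnormalActivityStatics

end
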